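import Literature.MathematicalPhysics.QuantumFieldTheory.Balaban1983to89.B3Ineq313Lattice
import Literature.MathematicalPhysics.QuantumFieldTheory.Balaban1983to89.B3Ineq211ZeroLattice
import Literature.MathematicalPhysics.QuantumFieldTheory.Balaban1983to89.B3GkZeroBoxSeparated

/-!
# `Balaban1983to89.B3Ineq314ZeroLattice` — T. Bałaban, *(Higgs)₂,₃ quantum fields in a finite volume. III. Renormalization*,
# Commun. Math. Phys. **88** (1983) 411–445 [Balaban1983Higgs3]: the estimates (3.13)/(3.14) p. 436 FOR THE PIECES OF THE PRINT'S
# OWN §3 PROPAGATOR `G_k(0) = G_k(ηℤ^{d+1}, 0)` — the kernel hypotheses ((2.10), its mixed-derivative clause) and the leg hypothesis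
# ((2.11)) of `B3Ineq313Lattice` DISCHARGED on `ηℤ^{d+1}`: (3.14) with NO kernel and NO leg hypothesis, pointwise and in the printed
# cube-localized form; (3.13) with the kernels discharged; and (3.15) p. 437 (the summation over the line indices giving the resummed
# propagator `G_{j″}(0)`) for the pieces of `G_k(0)`

statement-level skeleton of published theorems with citation tags; proofs where landed; nothing here is a claim about the Yang–Mills mass gap

PDF held: `paper:balaban1983-higgs-2-3-quantum-fields-finite-volume` (journal page = PDF page + 410); p. 426 [PDF 16] ((2.10)/(2.11)),
p. 433 [PDF 23] (*"with the scalar field propagator equal to G_k(0)"*), p. 436 [PDF 26] ((3.13)/(3.14), render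
`run/shared/lean/pub/pub-balaban/b2b-balaban-ref1/pages/1983-cmp88-higgs23-III/1983-cmp88-higgs23-III-p026-x2.png`).

CITATION HEADER (lean-in-tree rule).  Part of the lit-balaban TYPED SKELETON (HOME `run/shared/lean/pub/lit-balaban/`), Phase 2: FILE C
of p26 g34's three-file chain «(3.9)–(3.14) ON `ηℤ^{d+1}`» for SKELETON row **B3.Eq3.11-3.17** (fold owner r15; owner's head residual
2026-08-22T23:10Z *"… (3.13)/(3.14) there rest on (2.6)/(2.10) for G_k(0)'s pieces = your file"*).  FILE A = `B3Taylor310Lattice`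
((3.10) on `ℤ^{d+1}`), FILE B = `B3Ineq313Lattice` ((3.9)/(3.11)/(3.12) with bodies, (3.13)/(3.14) proved under kernel/leg hypotheses).
THIS FILE is the `ℤ^{d+1}` twin of p20 g6's torus file `B3Ineq314LegZeroTorus` (`leg_holder_of_ineq211`, `abs_term312_le_leg_zeroTorus`,
`abs_term312_le_leg_cubes_zeroTorus`).  CONSUMES BY NAME: p26 g34 `B3Ineq210ZeroLattice` (the lattice pieces `pieceLat`, their limits
`tendsto_pieceCube`, `pieceLat_of_le`), p26 g34 `B3Ineq211ZeroLattice` (the carrier `zeroLatticeKernelsH`, `ineq210_zeroLatticeH`,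
`ineq210_and_211At_zeroLatticeH` = (2.10) ∧ (2.11) DISCHARGED for the pieces), p03's `B3GkZeroBoxSeparated.abs_pieceMixed_le` (the
box-uniform mixed clause), p03 g8 `B3GkZeroLattice` (centred cubes `cubeM`, `ctr`, `LabRad`), FILE B's `abs_term312Z_le`,
`abs_term312Z_le_local`, `abs_term312Z_le_local_cubes`.  Nothing of another seat is modified.

WHAT IS PRINTED (p. 436, verbatim from the render; `d` = the print's dimension = this file's `d + 1`).  *"If φ′ is a leg of a propagator
with an index j″, whose second leg is localized in Δ(v″), then the last supremum in (3.13) can be estimated by O(1)(L^{j″}η)^{−d+1−α}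
sup_{x∈Δ(v),x′∈Δ(v′)} exp[−δ₀(L^{j″}η)^{−1}dist(Γ_{x,x′},Δ(v″))], and the exponential factor together with another exponential factor in
(3.13) give us the estimate (the expression (3.12)) ≦ O(1) Σ_{Δ(v),Δ(v′)} sup_{x∈Δ(v)}|φ(x)|(L^{j₁}η)^{2d}(L^jη)^{−d}·exp[−½δ₀(L^jη)^{−1}
dist(Δ(v),Δ(v′))](L^{j′}η)^{−d+2}exp[−½δ₀(L^{j′}η)^{−1}dist(Δ(v),Δ(v′))]·(L^{j₁}η)^{1+α}(L^{j″}η)^{−d+1−α}exp[−½δ₀(L^{j″}η)^{−1}dist(Δ(v),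
Δ(v″))] (there may be an additional negative power of L^{j″}η coming from differentiations in the vertex v″). (3.14)"*; p. 433: *"with
the scalar field propagator equal to G_k(0)"*; p. 434: *"We apply the decomposition (2.6) to the propagators G_k(0), G_k"*.

WHAT IS REPRODUCED, and how (kind «model-instance»; every theorem proved).
* §1 **`abs_pieceLatMixed_le`** — the mixed (twice-differentiated, once in each variable) (2.10) clause for the LATTICE pieces:
  `L^{2k}|G(x+e_μ,x′+e_ν) − G(x,x′+e_ν) − G(x+e_μ,x′) + G(x,x′)| ≤ C·L^{−j(d+1)}e^{−δ₁|x−x′|_∞/L^j}` for all `x, x′ ∈ ℤ^{d+1}` (p03's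
  box clause in the limit along the centred cubes, as `B3Ineq210ZeroLattice.abs_pieceLatDiff_le`).
* §2 the §3 kernels: `etaZ = η = L^{−k}`, `scaleZ j = L^jη` (= the carrier's `ScaledKernels.scale`, `rfl`), **`gpieceZ j = η^{−(d+1)}pieceLat j`**
  (= `G^η_{(j)}(0)` in the print's normalisation; `Σ_j` = `G_k(0)`), the `ℓ¹`/sup-norm dictionary (`|·|_∞ ≤ |·|₁ ≤ (d+1)|·|_∞`).
* §3 the hypotheses of FILE B DISCHARGED at any rate `δ′ ≤ δ₁/(d+1)`: **`abs_gpieceZ_le`** (`hGj'`, from `Ineq210` of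
  `zeroLatticeKernelsH`), **`abs_dKernelZ_gpieceZ_le`** (`hGj`: `|dKernelZ η⁻¹ μ (gpieceZ j)| ≤ C(L^jη)^{−(d+1)}e^{−δ′…}`, from §1).
* §4 the leg **`legZ j″ x″ w = G^η_{(j″)}(0)(·,x″)w`**, `pd_legZ`, **`leg_holder_of_ineq211Z`** (`hleg` with `C₃ = C(L^{j″}η)^{1−(d+1)−α}‖w‖`,
  from `Ineq211At α` of `zeroLatticeKernelsH`).
* §5 **`abs_term312Z_le_zeroLattice`** ((3.13), kernels discharged, external leg under its Hölder hypothesis, `0 ≤ α ≤ 1`);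
  **`abs_term312Z_le_leg_zeroLattice`** ((3.14) pointwise, NO kernel and NO leg hypothesis, each `0 ≤ α < 1`, all `j, j′ ≤ j″`):
  `|(3.12)| ≤ C′Q²‖w‖(L^{j″}η)^{1−(d+1)−α}(m·m^α)Σ_{x∈Λ,x′∈Λ′}η^{2(d+1)}‖φ(x)‖(L^jη)^{−(d+1)}e^{−½δ′…}(L^{j′}η)^{2−(d+1)}e^{−½δ′…}e^{−½δ′η|x−x″|₁/L^{j″}η}`;
  **`abs_term312Z_le_leg_cubes_zeroLattice`** (the same in the DISPLAYED cube-localized form, cubes `Δ(v), Δ(v′)` of side `M`, third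
  cube `Δ(v″) ∋ x″` of side `M″`).
* §6 (3.15) p. 437 on `ηℤ^{d+1}`: the resummed propagator **`GresumZ n = η^{−(d+1)}𝒢_n`** (`𝒢_n = GscaleLat n` of `B3Ineq210ZeroLattice`,
  `𝒢_k = G_k(0)`: `GresumZ_top`), `sum_pieceLat_range`/`sum_gpieceZ_range` (`Σ_{j<n} G^η_{(j)}(0) = 𝒢_n`), and **`eq315Z_zeroLattice`**:
  `Σ_{j,j′<n} term311Z(G^η_{(j)}(0), G^η_{(j′)}(0)) = term311Z(𝒢_n, 𝒢_n)` — *"After the summations we get … G_{j″}(0) … (3.15)"* (FILE B's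
  bilinearity `eq315Z_resum` + (2.6)).

HONEST SCOPE / DECLARED DIVERGENCES (F7).  (i) ZERO FIELD, `Ω = ηℤ^{d+1}`: all three lines `G^η_{(j)}(0)`, `G^η_{(j′)}(0)`, `G^η_{(j″)}(0)`
are (2.6)-pieces of the SAME zero-field infinite-lattice propagator `G_k(0)` — the printed §3 setting after the p. 433 reductions (the
print's `G_{(j′)}` without "(0)" is also a scalar piece there; external `B̃′`-legs are external fields); general `Ω`/`B̃` are the
torus/region members of the lineage.  (ii) The second leg of `G^η_{(j″)}` is a POINT `x″` (the sum over `x″ ∈ Δ(v″)` with the vertex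
function at `v″` belongs to the next vertex's estimate, as in the torus files).  (iii) PER-`α` constants with `α < 1` STRICT in the leg
versions (decl of record `Ineq211At`, GAPS G-B3-11); `δ₀ ↦ δ′` existential, one common rate for the three lines (the minimum of the
(2.10)/(2.11)/mixed rates divided by `d + 1` for the `|·|_∞ → |·|₁` conversion).  (iv) Distances `η|·|₁` (FILE B) versus `η|·|_∞`
(the (2.10)/(2.11) files): converted, not identified.  (v) The pieces are the kernel limits of `B3Ineq210ZeroLattice` (see its scope
notes); window `[a₋,a₊] × [0,m²₊]`, `a₋ > 0`, `L = ℓ + 1 ≥ 2`, every `k ≥ 1`.  Theorems + five definitions with bodies (`etaZ`, `scaleZ`,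
`gpieceZ`, `legZ`, `GresumZ`); no Literature fact minted, no `sorry`; standard axioms.  Value = (3.13)/(3.14) hypothesis-free on the printed
carrier, NOT summit progress.
Unit `lit-balaban-p26` (Phase-2 proof seat p26, gen 34); HOME `run/shared/lean/pub/lit-balaban/` (rows B3.Eq3.11-3.17 / B3.Eq2.10 /
B3.Eq2.11, FILED.md, STATUS.md), 2026-08-23.
-/

open scoped BigOperators RealInnerProductSpace

universe u

namespace Literature.MathematicalPhysics.QuantumFieldTheory.Balaban1983to89.B3Ineq314ZeroLattice

open Finset Filter Topology
open Literature.MathematicalPhysics.QuantumFieldTheory.Balaban1983to89.B4ContourShift (supNorm supNorm_nonneg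
  abs_le_supNorm exists_supNorm_eq)
open Literature.MathematicalPhysics.QuantumFieldTheory.Balaban1983to89.B4Reflection242
open Literature.MathematicalPhysics.QuantumFieldTheory.Balaban1983to89.B4BoxCov237
open Literature.MathematicalPhysics.QuantumFieldTheory.Balaban1983to89.B4TwoBox120
open Literature.MathematicalPhysics.QuantumFieldTheory.Balaban1983to89.B4Thm110ZeroBox
open Literature.MathematicalPhysics.QuantumFieldTheory.Balaban1983to89.B3GkZeroLattice
open Literature.MathematicalPhysics.QuantumFieldTheory.Balaban1983to89.B3Ineq210ZeroBox (piece)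
open Literature.MathematicalPhysics.QuantumFieldTheory.Balaban1983to89.B3Ineq210ZeroLattice
open Literature.MathematicalPhysics.QuantumFieldTheory.Balaban1983to89.B3Ineq211ZeroLattice
open Literature.MathematicalPhysics.QuantumFieldTheory.Balaban1983to89.B3GkZeroBoxSeparated (abs_pieceMixed_le)
open Literature.MathematicalPhysics.QuantumFieldTheory.Balaban1983to89.B3Sect2StatementsPart2 (ScaledKernels)
open B3Taylor310Lattice B3Ineq313Lattice
open B3Ineq314Cubes (supOn)

noncomputable section

variable {d : ℕ}

/-! ## §1 The mixed (2.10) clause for the lattice pieces: `∂^η_μ G^η_{(j)}(0) ∂^{η*}_μ` on `ηℤ^{d+1}` -/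

/-- kernel: centring commutes with a lattice translation. [folklore] -/
private theorem ctr_add_vec (n t : ℕ) (x v : Fin (d + 1) → ℤ) : ctr n t (x + v) = ctr n t x + v := by
  funext i; simp only [ctr_apply, Pi.add_apply]; ring

/-- **B3 (2.10) p. 426, TWICE-DIFFERENTIATED (MIXED) CLAUSE FOR THE LATTICE PIECES `G^η_{(j)}(0)` of `G_k(0) = G_k(ηℤ^{d+1},0)`**,
in lattice units (counting normalisation; zero field): *"if the propagator is differentiated, then for each differentiation, there is
an additional factor (L^jη)^{−1}"* — one derivative in each variable, the kernel `(∂^η_μG^η_{(j)}(0)∂^{η*}_ν)(x,x′)` of (3.9):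
`L^{2k}·|G(x+e_μ,x′+e_ν) − G(x,x′+e_ν) − G(x+e_μ,x′) + G(x,x′)| ≤ C·L^{−j(d+1)}·e^{−δ₁|x−x′|_∞/L^j}` for every `k ≥ 1`, `j < k`, window
point, axes `μ, ν` and ALL `x, x′ ∈ ℤ^{d+1}` — p03's box clause `B3GkZeroBoxSeparated.abs_pieceMixed_le` (uniform in the box) passed to
the limit along the centred cubes (`B3Ineq210ZeroLattice.tendsto_pieceCube`). [cite: Balaban1983Higgs3, (2.10) p.426] -/
theorem abs_pieceLatMixed_le (d ℓ : ℕ) (hℓ : 1 ≤ ℓ) (amin aplus m2plus : ℝ) (ha : 0 < amin) :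
    ∃ δ₁ C : ℝ, 0 < δ₁ ∧ 0 < C ∧ ∀ (k : ℕ), 1 ≤ k → ∀ (j : ℕ), j < k → ∀ (a m2 : ℝ), amin ≤ a → a ≤ aplus →
      0 ≤ m2 → m2 ≤ m2plus → ∀ (μ ν : Fin (d + 1)) (x x' : Fin (d + 1) → ℤ),
        ((((ℓ + 1) ^ k : ℕ)) : ℝ) ^ 2 *
            |(pieceLat ℓ k j a m2 (x + Pi.single μ 1) (x' + Pi.single ν 1) - pieceLat ℓ k j a m2 x (x' + Pi.single ν 1))
              - (pieceLat ℓ k j a m2 (x + Pi.single μ 1) x' - pieceLat ℓ k j a m2 x x')|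
          ≤ C * ((((bj ℓ j : ℕ) : ℝ) ^ (d + 1))⁻¹) * Real.exp (-(δ₁ * supNorm (x - x') / ((bj ℓ j : ℕ) : ℝ))) := by
  obtain ⟨δ₁, C, hδ₁, hC, h⟩ := abs_pieceMixed_le d ℓ hℓ amin aplus m2plus ha
  refine ⟨δ₁, C, hδ₁, hC, ?_⟩
  intro k hk j hjk a m2 h1 h2 h3 h4 μ ν x x'
  obtain ⟨R₁, hx, hx'⟩ := exists_labRad₂ ((ℓ + 1) ^ k) x x'
  obtain ⟨R₂, hxe, hxe'⟩ := exists_labRad₂ ((ℓ + 1) ^ k) (x + Pi.single μ 1) (x' + Pi.single ν 1)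
  have hn : 1 ≤ (ℓ + 1) ^ k := Nat.one_le_pow _ _ (by omega)
  have ha0 : 0 < a := ha.trans_le h1
  have hT := tendsto_pieceCube (d := d) (ℓ := ℓ) (k := k) (a := a) (m2 := m2) hℓ hk ha0 h3 j
  have hconv := ((((hT (x + Pi.single μ 1) (x' + Pi.single ν 1)).sub (hT x (x' + Pi.single ν 1))).sub
    ((hT (x + Pi.single μ 1) x').sub (hT x x'))).abs.const_mul (((((ℓ + 1) ^ k : ℕ)) : ℝ) ^ 2))
  refine le_of_tendsto hconv (eventually_atTop.2 ⟨R₁ + R₂, fun t ht => ?_⟩)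
  have hm := ctr_mem (d := d) hn (show R₁ ≤ t by omega) hx
  have hm' := ctr_mem (d := d) hn (show R₁ ≤ t by omega) hx'
  have hme := ctr_mem (d := d) hn (show R₂ ≤ t by omega) hxe
  have hme' := ctr_mem (d := d) hn (show R₂ ≤ t by omega) hxe'
  have hrel : ctr ((ℓ + 1) ^ k) t (x + Pi.single μ 1) = ctr ((ℓ + 1) ^ k) t x + Pi.single μ 1 := ctr_add_vec _ t x _
  have hrel' : ctr ((ℓ + 1) ^ k) t (x' + Pi.single ν 1) = ctr ((ℓ + 1) ^ k) t x' + Pi.single ν 1 := ctr_add_vec _ t x' _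
  have hb := h k hk j hjk a m2 h1 h2 h3 h4 (cubeM t) (cubeM_pos t) μ ν ⟨_, hm⟩ ⟨_, hme⟩ hrel ⟨_, hm'⟩ ⟨_, hme'⟩ hrel'
  rw [ctr_sub_ctr] at hb
  simpa only [pieceCube, dif_pos (And.intro hme hme'), dif_pos (And.intro hm hme'), dif_pos (And.intro hme hm'),
    dif_pos (And.intro hm hm')] using hb

/-! ## §2 The §3 kernels on `ηℤ^{d+1}`: the pieces of `G_k(0)` in the print's normalisation, scales, distances -/

/-- the lattice spacing `η = L^{−k}` (`L = ℓ + 1`). [cite: Balaban1983Higgs3, (2.6) p.424] -/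
def etaZ (ℓ k : ℕ) : ℝ := ((((ℓ + 1) ^ k : ℕ) : ℝ))⁻¹

/-- the length scale `L^jη` of the `j`-th piece (`= ScaledKernels.scale` of the carrier `zeroLatticeKernelsH`).
[cite: Balaban1983Higgs3, (2.10) p.426] -/
def scaleZ (ℓ k j : ℕ) : ℝ := ((ℓ : ℝ) + 1) ^ j * ((((ℓ + 1) ^ k : ℕ) : ℝ))⁻¹

/-- **The pieces `G^η_{(j)}(0)` of the §3 propagator `G_k(0) = G_k(ηℤ^{d+1}, 0)` as Sect.-3 kernels on `ℤ^{d+1}`** in the print's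
`η^d`-normalisation: `η^{−(d+1)}·pieceLat j` (`B3Ineq210ZeroLattice.pieceLat`, the kernel limits of p03's box pieces; `Σ_j` of them is
`G_k(0)`, `sum_pieceLat`). [cite: Balaban1983Higgs3, (2.6) p.424, (3.9) p.435] -/
def gpieceZ (ℓ k j : ℕ) (a m2 : ℝ) : KernelZ d :=
  fun x x' => ((((ℓ + 1) ^ k : ℕ) : ℝ)) ^ (d + 1) * pieceLat ℓ k j a m2 x x'

section Dictionary

variable {ℓ k : ℕ}

/-- `η > 0`. [cite: Balaban1983Higgs3, (2.6) p.424] -/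
theorem etaZ_pos (ℓ k : ℕ) : 0 < etaZ ℓ k := by unfold etaZ; positivity

/-- `L^jη > 0`. [cite: Balaban1983Higgs3, (2.10) p.426] -/
theorem scaleZ_pos (ℓ k j : ℕ) : 0 < scaleZ ℓ k j := by unfold scaleZ; positivity

/-- the carrier's scale IS `scaleZ`. [cite: Balaban1983Higgs3, (2.10) p.426] -/
theorem scale_zeroLatticeKernelsH (hℓ : 1 ≤ ℓ) (a m2 : ℝ) (j : ℕ) :
    (zeroLatticeKernelsH d ℓ k hℓ a m2).scale j = scaleZ ℓ k j := rfl

/-- `L^jη ≤ L^{j″}η` for `j ≤ j″` (*"they are earlier than the external lines"*). [cite: Balaban1983Higgs3, (3.14) p.436] -/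
theorem scaleZ_mono {j j'' : ℕ} (h : j ≤ j'') : scaleZ ℓ k j ≤ scaleZ ℓ k j'' := by
  unfold scaleZ
  have hL : (1 : ℝ) ≤ (ℓ : ℝ) + 1 := le_add_of_nonneg_left (Nat.cast_nonneg ℓ)
  exact mul_le_mul_of_nonneg_right (pow_le_pow_right₀ hL h) (inv_nonneg.2 (Nat.cast_nonneg _))

/-- `(L^jη)^{−1}·η·D = D/L^j`. [cite: Balaban1983Higgs3, (2.10) p.426] -/
theorem scaleZ_inv_mul_etaZ_mul (j : ℕ) (D : ℝ) : (scaleZ ℓ k j)⁻¹ * (etaZ ℓ k * D) = D / ((bj ℓ j : ℕ) : ℝ) := by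
  have hLk : (0 : ℝ) < (((ℓ + 1) ^ k : ℕ) : ℝ) := by positivity
  have hLj : (0 : ℝ) < ((ℓ : ℝ) + 1) ^ j := by positivity
  rw [bj_cast]
  unfold scaleZ etaZ
  field_simp

/-- `(L^jη)^{−(d+1)} = s_j^{d+1}` and `η^{−(d+1)}L^{−j(d+1)} = s_j^{d+1}` (`j ≤ k`, `s_j = L^{k−j}`). [folklore] -/
private theorem Lk_pow_mul_inv_bj_pow {j : ℕ} (hj : j ≤ k) (n : ℕ) :
    ((((ℓ + 1) ^ k : ℕ) : ℝ)) ^ n * ((((bj ℓ j : ℕ) : ℝ)) ^ n)⁻¹ = sc ℓ k j ^ n := by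
  have h := sc_mul_bj (ℓ := ℓ) hj
  rw [bj_cast] at h
  have hL : (0 : ℝ) < ((ℓ : ℝ) + 1) ^ j := by positivity
  push_cast [bj_cast]
  rw [← h, mul_pow]
  field_simp

/-- kernel: `(s⁻¹)^{−n} = s^n` (real exponent). [folklore] -/
private theorem inv_rpow_neg_natCast {s : ℝ} (hs : 0 < s) (n : ℕ) : (s⁻¹) ^ (-(n : ℝ)) = s ^ n := by
  rw [Real.rpow_neg (inv_nonneg.2 hs.le), Real.inv_rpow hs.le, inv_inv, Real.rpow_natCast]

/-- `|x − x′|_∞ ≤ |x − x′|₁`. [folklore] -/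
private theorem supNorm_sub_le_dist₁ (x x' : Fin (d + 1) → ℤ) : supNorm (x - x') ≤ (dist₁ x x' : ℝ) := by
  obtain ⟨i, hi⟩ := exists_supNorm_eq (x - x')
  rw [hi]
  have h := natAbs_sub_le_dist₁ x x' i
  have hc : ((|(x - x') i| : ℤ) : ℝ) = (((x i - x' i).natAbs : ℕ) : ℝ) := by
    rw [Pi.sub_apply, ← Int.natCast_natAbs, Int.cast_natCast]
  rw [hc]
  exact_mod_cast h

/-- `|x − x′|₁ ≤ (d+1)|x − x′|_∞`. [folklore] -/
private theorem dist₁_le_mul_supNorm (x x' : Fin (d + 1) → ℤ) :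
    (dist₁ x x' : ℝ) ≤ ((d + 1 : ℕ) : ℝ) * supNorm (x - x') := by
  have hterm : ∀ μ : Fin (d + 1), (((x μ - x' μ).natAbs : ℕ) : ℝ) ≤ supNorm (x - x') := by
    intro μ
    have h := abs_le_supNorm (x - x') μ
    rwa [Pi.sub_apply, ← Int.natCast_natAbs, Int.cast_natCast] at h
  unfold dist₁
  push_cast
  calc ∑ μ : Fin (d + 1), (((x μ - x' μ).natAbs : ℕ) : ℝ) ≤ ∑ _μ : Fin (d + 1), supNorm (x - x') :=
        Finset.sum_le_sum fun μ _ => hterm μ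
    _ = ((d : ℝ) + 1) * supNorm (x - x') := by
        rw [Finset.sum_const, Finset.card_univ, Fintype.card_fin, nsmul_eq_mul]; push_cast; ring

/-- `x ≠ y ⇒ |x − y|_∞ > 0`. [folklore] -/
private theorem supNorm_pos_of_ne {x y : Fin (d + 1) → ℤ} (h : x ≠ y) : 0 < supNorm (x - y) := by
  obtain ⟨i, hi⟩ : ∃ i, x i ≠ y i := by
    by_contra hcon
    push Not at hcon
    exact h (funext hcon)
  have h1 : (1 : ℝ) ≤ ((|(x - y) i| : ℤ) : ℝ) := by
    have : (1 : ℤ) ≤ |(x - y) i| := by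
      rw [Pi.sub_apply]; exact Int.one_le_abs (sub_ne_zero.2 hi)
    exact_mod_cast this
  linarith [abs_le_supNorm (x - y) i]

/-- kernel: the rate conversion `δ′·|x−x′|₁ ≤ δ·|x−x′|_∞` for `δ′ ≤ δ/(d+1)`. [folklore] -/
private theorem rate_mul_dist₁_le {δ δ' : ℝ} (hδ' : δ' ≤ δ / ((d + 1 : ℕ) : ℝ)) (hδ'0 : 0 ≤ δ') (x x' : Fin (d + 1) → ℤ) :
    δ' * (dist₁ x x' : ℝ) ≤ δ * supNorm (x - x') := by
  have hd1 : (0 : ℝ) < ((d + 1 : ℕ) : ℝ) := by positivity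
  have hδ0 : 0 ≤ δ / ((d + 1 : ℕ) : ℝ) := hδ'0.trans hδ'
  calc δ' * (dist₁ x x' : ℝ) ≤ (δ / ((d + 1 : ℕ) : ℝ)) * (((d + 1 : ℕ) : ℝ) * supNorm (x - x')) :=
        mul_le_mul hδ' (dist₁_le_mul_supNorm x x') (Nat.cast_nonneg _) hδ0
    _ = δ * supNorm (x - x') := by field_simp

/-- kernel: the same for the two-point distance `min(|z−x″|, |z′−x″|)`. [folklore] -/
private theorem rate_mul_min_dist₁_le {δ δ' : ℝ} (hδ' : δ' ≤ δ / ((d + 1 : ℕ) : ℝ)) (hδ'0 : 0 ≤ δ')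
    (z z' x'' : Fin (d + 1) → ℤ) :
    δ' * ((min (dist₁ z x'') (dist₁ z' x'') : ℕ) : ℝ) ≤ δ * min (supNorm (z' - x'')) (supNorm (z - x'')) := by
  have hd1 : (0 : ℝ) < ((d + 1 : ℕ) : ℝ) := by positivity
  have hδ0 : 0 ≤ δ / ((d + 1 : ℕ) : ℝ) := hδ'0.trans hδ'
  have hmin : ((min (dist₁ z x'') (dist₁ z' x'') : ℕ) : ℝ) ≤
      ((d + 1 : ℕ) : ℝ) * min (supNorm (z' - x'')) (supNorm (z - x'')) := by
    rw [Nat.cast_min, mul_min_of_nonneg _ _ hd1.le]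
    exact le_min ((min_le_right _ _).trans (dist₁_le_mul_supNorm z' x''))
      ((min_le_left _ _).trans (dist₁_le_mul_supNorm z x''))
  calc δ' * ((min (dist₁ z x'') (dist₁ z' x'') : ℕ) : ℝ)
      ≤ (δ / ((d + 1 : ℕ) : ℝ)) * (((d + 1 : ℕ) : ℝ) * min (supNorm (z' - x'')) (supNorm (z - x''))) :=
        mul_le_mul hδ' hmin (Nat.cast_nonneg _) hδ0
    _ = δ * min (supNorm (z' - x'')) (supNorm (z - x'')) := by field_simp

end Dictionary

/-! ## §3 The (3.13)/(3.14) kernel hypotheses DISCHARGED for the pieces of `G_k(0)` (at any rate `δ′ ≤ δ₁/(d+1)`) -/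

section Bounds

variable {ℓ k : ℕ} {a m2 : ℝ}

/-- kernel: `e^{−δ₁|x−x′|_∞/L^j} ≤ e^{−δ′(L^jη)^{−1}η|x−x′|₁}` for `δ′ ≤ δ₁/(d+1)` (sup norm versus `ℓ¹` norm). [folklore] -/
private theorem exp_sup_le_exp_dist₁ {δ₁ δ' : ℝ} (hδ'0 : 0 ≤ δ') (hδ' : δ' ≤ δ₁ / ((d + 1 : ℕ) : ℝ)) (j : ℕ)
    (x x' : Fin (d + 1) → ℤ) :
    Real.exp (-(δ₁ * supNorm (x - x') / ((bj ℓ j : ℕ) : ℝ))) ≤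
      Real.exp (-(δ' * (scaleZ ℓ k j)⁻¹ * (etaZ ℓ k * dist₁ x x'))) := by
  have hbj : (0 : ℝ) < ((bj ℓ j : ℕ) : ℝ) := by exact_mod_cast bj_pos ℓ j
  have h1 := rate_mul_dist₁_le hδ' hδ'0 x x'
  rw [Real.exp_le_exp, neg_le_neg_iff, mul_assoc, scaleZ_inv_mul_etaZ_mul, ← mul_div_assoc]
  exact div_le_div_of_nonneg_right h1 hbj.le

/-- **The (2.10) value clause in the shape of the (3.13) hypothesis `hGj'`**: from `Ineq210 δ₁ C` of the carrier
`zeroLatticeKernelsH` (`B3Ineq211ZeroLattice.ineq210_zeroLatticeH`), for every rate `0 ≤ δ′ ≤ δ₁/(d+1)`, every `j` and ALL `x, x′`: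
`|G^η_{(j)}(0)(x,x′)| ≤ C(L^jη)^{2−(d+1)}e^{−δ′(L^jη)^{−1}η|x−x′|₁}` (`G^η_{(j)}(0) = gpieceZ j`). [cite: Balaban1983Higgs3, (2.10) p.426] -/
theorem abs_gpieceZ_le (hℓ : 1 ≤ ℓ) {δ₁ C : ℝ} (h210 : (zeroLatticeKernelsH d ℓ k hℓ a m2).Ineq210 δ₁ C)
    {δ' : ℝ} (hδ'0 : 0 ≤ δ') (hδ' : δ' ≤ δ₁ / ((d + 1 : ℕ) : ℝ)) (j : ℕ) (x x' : Fin (d + 1) → ℤ) :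
    |gpieceZ ℓ k j a m2 x x'| ≤ C * scaleZ ℓ k j ^ (2 - ((d + 1 : ℕ) : ℝ)) *
      Real.exp (-(δ' * (scaleZ ℓ k j)⁻¹ * (etaZ ℓ k * dist₁ x x'))) := by
  have hLk : (0 : ℝ) < (((ℓ + 1) ^ k : ℕ) : ℝ) := by positivity
  have hs : 0 < scaleZ ℓ k j := scaleZ_pos ℓ k j
  have hη : 0 < etaZ ℓ k := etaZ_pos ℓ k
  have h := (h210 j x x').1
  change ((((ℓ + 1) ^ k : ℕ) : ℝ)) ^ (d + 1) * |pieceLat ℓ k j a m2 x x'| ≤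
    C * scaleZ ℓ k j ^ (2 - ((d + 1 : ℕ) : ℝ)) *
      Real.exp (-(δ₁ * (scaleZ ℓ k j)⁻¹ * (supNorm (x - x') / (((ℓ + 1) ^ k : ℕ) : ℝ)))) at h
  have hC : 0 ≤ C * scaleZ ℓ k j ^ (2 - ((d + 1 : ℕ) : ℝ)) :=
    nonneg_of_mul_nonneg_left (le_trans (by positivity) h) (Real.exp_pos _)
  have habs : |gpieceZ ℓ k j a m2 x x'| = ((((ℓ + 1) ^ k : ℕ) : ℝ)) ^ (d + 1) * |pieceLat ℓ k j a m2 x x'| := by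
    rw [gpieceZ, abs_mul, abs_of_nonneg (by positivity : (0:ℝ) ≤ ((((ℓ + 1) ^ k : ℕ) : ℝ)) ^ (d + 1))]
  rw [habs]
  refine h.trans (mul_le_mul_of_nonneg_left ?_ hC)
  rw [Real.exp_le_exp, neg_le_neg_iff]
  have h1 := rate_mul_dist₁_le hδ' hδ'0 x x'
  have hc : 0 ≤ (scaleZ ℓ k j)⁻¹ * etaZ ℓ k := mul_nonneg (inv_nonneg.2 hs.le) hη.le
  calc δ' * (scaleZ ℓ k j)⁻¹ * (etaZ ℓ k * (dist₁ x x' : ℝ))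
      = ((scaleZ ℓ k j)⁻¹ * etaZ ℓ k) * (δ' * (dist₁ x x' : ℝ)) := by ring
    _ ≤ ((scaleZ ℓ k j)⁻¹ * etaZ ℓ k) * (δ₁ * supNorm (x - x')) := mul_le_mul_of_nonneg_left h1 hc
    _ = δ₁ * (scaleZ ℓ k j)⁻¹ * (supNorm (x - x') / (((ℓ + 1) ^ k : ℕ) : ℝ)) := by unfold etaZ; ring

/-- **The mixed (2.10) clause in the shape of the (3.13) hypothesis `hGj`**: from `abs_pieceLatMixed_le` (rate `δ₁`, constant `C`),
for every rate `0 ≤ δ′ ≤ δ₁/(d+1)`, every `j`, axis `μ` and ALL `x, x′`: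
`|(∂^η_μG^η_{(j)}(0)∂^{η*}_μ)(x,x′)| ≤ C(L^jη)^{−(d+1)}e^{−δ′(L^jη)^{−1}η|x−x′|₁}` (kernel `dKernelZ η⁻¹ μ (gpieceZ j)`; for `j ≥ k` there is
no piece and the kernel vanishes). [cite: Balaban1983Higgs3, (2.10) p.426, (3.13) p.436] -/
theorem abs_dKernelZ_gpieceZ_le (hℓ : 1 ≤ ℓ) (hk : 1 ≤ k) {δ₁ C : ℝ} (hC : 0 ≤ C)
    (hM : ∀ (j : ℕ), j < k → ∀ (μ ν : Fin (d + 1)) (x x' : Fin (d + 1) → ℤ),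
      ((((ℓ + 1) ^ k : ℕ)) : ℝ) ^ 2 *
          |(pieceLat ℓ k j a m2 (x + Pi.single μ 1) (x' + Pi.single ν 1) - pieceLat ℓ k j a m2 x (x' + Pi.single ν 1))
            - (pieceLat ℓ k j a m2 (x + Pi.single μ 1) x' - pieceLat ℓ k j a m2 x x')|
        ≤ C * ((((bj ℓ j : ℕ) : ℝ) ^ (d + 1))⁻¹) * Real.exp (-(δ₁ * supNorm (x - x') / ((bj ℓ j : ℕ) : ℝ))))
    {δ' : ℝ} (hδ'0 : 0 ≤ δ') (hδ' : δ' ≤ δ₁ / ((d + 1 : ℕ) : ℝ)) (j : ℕ) (μ : Fin (d + 1))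
    (x x' : Fin (d + 1) → ℤ) :
    |dKernelZ (etaZ ℓ k)⁻¹ μ (gpieceZ ℓ k j a m2) x x'| ≤ C * scaleZ ℓ k j ^ (-((d + 1 : ℕ) : ℝ)) *
      Real.exp (-(δ' * (scaleZ ℓ k j)⁻¹ * (etaZ ℓ k * dist₁ x x'))) := by
  have hLk : (0 : ℝ) < (((ℓ + 1) ^ k : ℕ) : ℝ) := by positivity
  have hs : 0 < scaleZ ℓ k j := scaleZ_pos ℓ k j
  -- the kernel as the mixed second difference of the lattice piece
  have hker : dKernelZ (etaZ ℓ k)⁻¹ μ (gpieceZ ℓ k j a m2) x x' =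
      ((((ℓ + 1) ^ k : ℕ) : ℝ)) ^ (d + 1) * (((((ℓ + 1) ^ k : ℕ)) : ℝ) ^ 2 *
        ((pieceLat ℓ k j a m2 (x + Pi.single μ 1) (x' + Pi.single μ 1) - pieceLat ℓ k j a m2 x (x' + Pi.single μ 1))
          - (pieceLat ℓ k j a m2 (x + Pi.single μ 1) x' - pieceLat ℓ k j a m2 x x'))) := by
    simp only [dKernelZ, gpieceZ, etaZ, inv_inv]; ring
  have hRHS : 0 ≤ C * scaleZ ℓ k j ^ (-((d + 1 : ℕ) : ℝ)) *
      Real.exp (-(δ' * (scaleZ ℓ k j)⁻¹ * (etaZ ℓ k * dist₁ x x'))) :=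
    mul_nonneg (mul_nonneg hC (Real.rpow_pos_of_pos hs _).le) (Real.exp_pos _).le
  rcases Nat.lt_or_ge j k with hjk | hkj
  · have hb := hM j hjk μ μ x x'
    have hpow : scaleZ ℓ k j ^ (-((d + 1 : ℕ) : ℝ)) = sc ℓ k j ^ (d + 1) := by
      rw [← scale_zeroLatticeKernelsH (d := d) hℓ a m2 j, scaleH_eq hjk.le, inv_rpow_neg_natCast (sc_pos ℓ k j)]
    rw [hker, abs_mul, abs_of_nonneg (by positivity : (0:ℝ) ≤ ((((ℓ + 1) ^ k : ℕ) : ℝ)) ^ (d + 1)), abs_mul,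
      abs_of_nonneg (by positivity : (0:ℝ) ≤ ((((ℓ + 1) ^ k : ℕ) : ℝ)) ^ 2)]
    calc ((((ℓ + 1) ^ k : ℕ) : ℝ)) ^ (d + 1) * (((((ℓ + 1) ^ k : ℕ)) : ℝ) ^ 2 *
          |(pieceLat ℓ k j a m2 (x + Pi.single μ 1) (x' + Pi.single μ 1) - pieceLat ℓ k j a m2 x (x' + Pi.single μ 1))
            - (pieceLat ℓ k j a m2 (x + Pi.single μ 1) x' - pieceLat ℓ k j a m2 x x')|)
        ≤ ((((ℓ + 1) ^ k : ℕ) : ℝ)) ^ (d + 1) * (C * ((((bj ℓ j : ℕ) : ℝ) ^ (d + 1))⁻¹)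
            * Real.exp (-(δ₁ * supNorm (x - x') / ((bj ℓ j : ℕ) : ℝ)))) :=
          mul_le_mul_of_nonneg_left hb (by positivity)
      _ = C * (((((ℓ + 1) ^ k : ℕ) : ℝ)) ^ (d + 1) * ((((bj ℓ j : ℕ) : ℝ)) ^ (d + 1))⁻¹)
            * Real.exp (-(δ₁ * supNorm (x - x') / ((bj ℓ j : ℕ) : ℝ))) := by ring
      _ = C * scaleZ ℓ k j ^ (-((d + 1 : ℕ) : ℝ)) * Real.exp (-(δ₁ * supNorm (x - x') / ((bj ℓ j : ℕ) : ℝ))) := by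
          rw [Lk_pow_mul_inv_bj_pow hjk.le, hpow]
      _ ≤ C * scaleZ ℓ k j ^ (-((d + 1 : ℕ) : ℝ)) * Real.exp (-(δ' * (scaleZ ℓ k j)⁻¹ * (etaZ ℓ k * dist₁ x x'))) :=
          mul_le_mul_of_nonneg_left (exp_sup_le_exp_dist₁ hδ'0 hδ' j x x')
            (mul_nonneg hC (Real.rpow_pos_of_pos hs _).le)
  · -- no piece for `j ≥ k ≥ 1`
    have hj1 : 1 ≤ j := le_trans hk hkj
    have hp : ∀ y y' : Fin (d + 1) → ℤ, pieceLat ℓ k j a m2 y y' = 0 := fun y y' => pieceLat_of_le hj1 hkj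
    rw [hker]
    simp only [hp, sub_self, mul_zero, abs_zero]
    exact hRHS

end Bounds

/-! ## §4 The leg `φ′ = G^η_{(j″)}(0)(·, x″)w` and its localized Hölder bound FROM (2.11) -/

section Leg

variable {ℓ k : ℕ} {a m2 : ℝ} {W : Type u} [NormedAddCommGroup W] [InnerProductSpace ℝ W]

/-- **The leg of (3.14)**: *"If φ′ is a leg of a propagator with an index j″, whose second leg is localized in Δ(v″)"* — the field
`φ′(y) = G^η_{(j″)}(0)(y, x″)·w` of the propagator piece with its second leg at the point `x″ ∈ Δ(v″)` (`w` the internal-index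
vector carried by the line). [cite: Balaban1983Higgs3, (3.14) p.436] -/
def legZ (ℓ k j'' : ℕ) (a m2 : ℝ) (x'' : Fin (d + 1) → ℤ) (w : W) : (Fin (d + 1) → ℤ) → W :=
  fun y => gpieceZ ℓ k j'' a m2 y x'' • w

/-- the derivative of the leg is the row-differentiated kernel times `w`. [cite: Balaban1983Higgs3, (3.14) p.436] -/
theorem pd_legZ (c : ℝ) (j'' : ℕ) (μ : Fin (d + 1)) (x'' : Fin (d + 1) → ℤ) (w : W) (z : Fin (d + 1) → ℤ) :
    pd c μ (legZ ℓ k j'' a m2 x'' w) z =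
      (c * (gpieceZ ℓ k j'' a m2 (z + Pi.single μ 1) x'' - gpieceZ ℓ k j'' a m2 z x'')) • w := by
  simp only [pd, legZ, ← sub_smul, smul_smul]

/-- **The localized Hölder bound of the leg FROM (2.11)** (the `ℤ^{d+1}` twin of p20 g6's `B3Ineq314LegZeroTorus.leg_holder_of_ineq211`):
if the lattice pieces satisfy `Ineq211At α δ₁ C` on the carrier `zeroLatticeKernelsH` (*"|x₂−x₁|^{−α}|(D^η_μG^η_{(j)})(x₂,x) −
(D^η_μG^η_{(j)})(x₁,x)| ≤ O(1)(L^jη)^{−d+1−α}e^{−δ₁(L^jη)^{−1}dist({x₁,x₂},x)}"*, `B3Ineq211ZeroLattice.ineq211At_zeroLatticeH`), then the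
leg `φ′ = G^η_{(j″)}(0)(·,x″)w` obeys, for every direction `μ`, ALL `z, z′` and every rate `0 ≤ δ′ ≤ δ₁/(d+1)`:
`‖(∂^η_μφ′)(z) − (∂^η_μφ′)(z′)‖ ≤ C(L^{j″}η)^{1−(d+1)−α}‖w‖·(η|z−z′|₁)^α·e^{−δ′(L^{j″}η)^{−1}η·min(|z−x″|₁,|z′−x″|₁)}` — the hypothesis `hleg` of
`B3Ineq313Lattice.abs_term312Z_le_local` with `C₃ = C(L^{j″}η)^{1−(d+1)−α}‖w‖` (*"O(1)(L^{j″}η)^{−d+1−α}"*).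
[cite: Balaban1983Higgs3, (2.11) p.426, (3.14) p.436] -/
theorem leg_holder_of_ineq211Z (hℓ : 1 ≤ ℓ) {α δ₁ C : ℝ} (hα0 : 0 ≤ α) (hC : 0 ≤ C)
    (h211 : (zeroLatticeKernelsH d ℓ k hℓ a m2).Ineq211At α δ₁ C) {δ' : ℝ} (hδ'0 : 0 ≤ δ')
    (hδ' : δ' ≤ δ₁ / ((d + 1 : ℕ) : ℝ)) (j'' : ℕ) (x'' : Fin (d + 1) → ℤ) (w : W) (μ : Fin (d + 1))
    (z z' : Fin (d + 1) → ℤ) :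
    ‖pd (etaZ ℓ k)⁻¹ μ (legZ ℓ k j'' a m2 x'' w) z - pd (etaZ ℓ k)⁻¹ μ (legZ ℓ k j'' a m2 x'' w) z'‖ ≤
      (C * scaleZ ℓ k j'' ^ (1 - ((d + 1 : ℕ) : ℝ) - α) * ‖w‖) * (etaZ ℓ k * dist₁ z z') ^ α *
        Real.exp (-(δ' * (scaleZ ℓ k j'')⁻¹ * (etaZ ℓ k * ((min (dist₁ z x'') (dist₁ z' x'') : ℕ) : ℝ)))) := by
  have hLk : (0 : ℝ) < (((ℓ + 1) ^ k : ℕ) : ℝ) := by positivity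
  have hs : 0 < scaleZ ℓ k j'' := scaleZ_pos ℓ k j''
  have hη : 0 < etaZ ℓ k := etaZ_pos ℓ k
  have hsp : 0 ≤ C * scaleZ ℓ k j'' ^ (1 - ((d + 1 : ℕ) : ℝ) - α) := mul_nonneg hC (Real.rpow_pos_of_pos hs _).le
  -- the norm is the Hölder numerator of (2.11) times `‖w‖`
  have hnorm : ‖pd (etaZ ℓ k)⁻¹ μ (legZ ℓ k j'' a m2 x'' w) z - pd (etaZ ℓ k)⁻¹ μ (legZ ℓ k j'' a m2 x'' w) z'‖ =
      ((((ℓ + 1) ^ k : ℕ) : ℝ)) ^ (d + 1) * (((((ℓ + 1) ^ k : ℕ) : ℝ)) *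
        |(pieceLat ℓ k j'' a m2 (z + Pi.single μ 1) x'' - pieceLat ℓ k j'' a m2 z x'')
          - (pieceLat ℓ k j'' a m2 (z' + Pi.single μ 1) x'' - pieceLat ℓ k j'' a m2 z' x'')|) * ‖w‖ := by
    rw [pd_legZ, pd_legZ, ← sub_smul, norm_smul, Real.norm_eq_abs]
    congr 1
    have hre : (etaZ ℓ k)⁻¹ * (gpieceZ ℓ k j'' a m2 (z + Pi.single μ 1) x'' - gpieceZ ℓ k j'' a m2 z x'') -
        (etaZ ℓ k)⁻¹ * (gpieceZ ℓ k j'' a m2 (z' + Pi.single μ 1) x'' - gpieceZ ℓ k j'' a m2 z' x'') =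
        ((((ℓ + 1) ^ k : ℕ) : ℝ)) ^ (d + 1) * (((((ℓ + 1) ^ k : ℕ) : ℝ)) *
          ((pieceLat ℓ k j'' a m2 (z + Pi.single μ 1) x'' - pieceLat ℓ k j'' a m2 z x'')
            - (pieceLat ℓ k j'' a m2 (z' + Pi.single μ 1) x'' - pieceLat ℓ k j'' a m2 z' x''))) := by
      simp only [gpieceZ, etaZ, inv_inv]; ring
    rw [hre, abs_mul, abs_of_nonneg (by positivity : (0:ℝ) ≤ ((((ℓ + 1) ^ k : ℕ) : ℝ)) ^ (d + 1)), abs_mul,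
      abs_of_nonneg hLk.le]
  rw [hnorm]
  by_cases hzz : z = z'
  · subst hzz
    simp only [sub_self, abs_zero, mul_zero, zero_mul]
    positivity
  -- (2.11) at `x₁ = z′`, `x₂ = z`, `x = x″`, multiplied through by `dist(z′,z)^α > 0`
  have hdpos : 0 < (zeroLatticeKernelsH d ℓ k hℓ a m2).dist z' z := by
    show 0 < supNorm (z' - z) / (((ℓ + 1) ^ k : ℕ) : ℝ)
    exact div_pos (supNorm_pos_of_ne (Ne.symm hzz)) hLk
  have h := h211 j'' μ z' z x'' (Ne.symm hzz)
  rw [div_le_iff₀ (Real.rpow_pos_of_pos hdpos α)] at h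
  change ((((ℓ + 1) ^ k : ℕ) : ℝ)) ^ (d + 1) * (((((ℓ + 1) ^ k : ℕ) : ℝ)) *
        |(pieceLat ℓ k j'' a m2 (z + Pi.single μ 1) x'' - pieceLat ℓ k j'' a m2 z x'')
          - (pieceLat ℓ k j'' a m2 (z' + Pi.single μ 1) x'' - pieceLat ℓ k j'' a m2 z' x'')|) ≤
      C * scaleZ ℓ k j'' ^ (1 - ((d + 1 : ℕ) : ℝ) - α) *
        Real.exp (-(δ₁ * (scaleZ ℓ k j'')⁻¹ *
          (min (supNorm (z' - x'')) (supNorm (z - x'')) / (((ℓ + 1) ^ k : ℕ) : ℝ)))) *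
        (supNorm (z' - z) / (((ℓ + 1) ^ k : ℕ) : ℝ)) ^ α at h
  -- conversions: `|·|_∞ ≤ |·|₁` in the Hölder factor, `δ′|·|₁ ≤ δ₁|·|_∞` in the exponential
  have hdist : (supNorm (z' - z) / (((ℓ + 1) ^ k : ℕ) : ℝ)) ^ α ≤ (etaZ ℓ k * dist₁ z z') ^ α := by
    refine Real.rpow_le_rpow (div_nonneg (supNorm_nonneg _) hLk.le) ?_ hα0
    show supNorm (z' - z) / (((ℓ + 1) ^ k : ℕ) : ℝ) ≤ ((((ℓ + 1) ^ k : ℕ) : ℝ))⁻¹ * (dist₁ z z' : ℝ)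
    rw [div_eq_inv_mul, ← neg_sub, B4TorusKernel.supNorm_neg]
    exact mul_le_mul_of_nonneg_left (supNorm_sub_le_dist₁ z z') (inv_nonneg.2 hLk.le)
  have hexp : Real.exp (-(δ₁ * (scaleZ ℓ k j'')⁻¹ *
        (min (supNorm (z' - x'')) (supNorm (z - x'')) / (((ℓ + 1) ^ k : ℕ) : ℝ)))) ≤
      Real.exp (-(δ' * (scaleZ ℓ k j'')⁻¹ * (etaZ ℓ k * ((min (dist₁ z x'') (dist₁ z' x'') : ℕ) : ℝ)))) := by
    rw [Real.exp_le_exp, neg_le_neg_iff]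
    have h1 := rate_mul_min_dist₁_le hδ' hδ'0 z z' x''
    have hc : 0 ≤ (scaleZ ℓ k j'')⁻¹ * etaZ ℓ k := mul_nonneg (inv_nonneg.2 hs.le) hη.le
    calc δ' * (scaleZ ℓ k j'')⁻¹ * (etaZ ℓ k * ((min (dist₁ z x'') (dist₁ z' x'') : ℕ) : ℝ))
        = ((scaleZ ℓ k j'')⁻¹ * etaZ ℓ k) * (δ' * ((min (dist₁ z x'') (dist₁ z' x'') : ℕ) : ℝ)) := by ring
      _ ≤ ((scaleZ ℓ k j'')⁻¹ * etaZ ℓ k) * (δ₁ * min (supNorm (z' - x'')) (supNorm (z - x''))) :=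
          mul_le_mul_of_nonneg_left h1 hc
      _ = δ₁ * (scaleZ ℓ k j'')⁻¹ * (min (supNorm (z' - x'')) (supNorm (z - x'')) / (((ℓ + 1) ^ k : ℕ) : ℝ)) := by
          unfold etaZ; ring
  calc ((((ℓ + 1) ^ k : ℕ) : ℝ)) ^ (d + 1) * (((((ℓ + 1) ^ k : ℕ) : ℝ)) *
        |(pieceLat ℓ k j'' a m2 (z + Pi.single μ 1) x'' - pieceLat ℓ k j'' a m2 z x'')
          - (pieceLat ℓ k j'' a m2 (z' + Pi.single μ 1) x'' - pieceLat ℓ k j'' a m2 z' x'')|) * ‖w‖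
      ≤ (C * scaleZ ℓ k j'' ^ (1 - ((d + 1 : ℕ) : ℝ) - α) *
          Real.exp (-(δ' * (scaleZ ℓ k j'')⁻¹ * (etaZ ℓ k * ((min (dist₁ z x'') (dist₁ z' x'') : ℕ) : ℝ)))) *
          (etaZ ℓ k * dist₁ z z') ^ α) * ‖w‖ := by
        refine mul_le_mul_of_nonneg_right (h.trans ?_) (norm_nonneg _)
        exact mul_le_mul (mul_le_mul_of_nonneg_left hexp hsp) hdist
          (Real.rpow_nonneg (div_nonneg (supNorm_nonneg _) hLk.le) _) (by positivity)
    _ = _ := by ring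

end Leg

/-! ## §5 (3.13)/(3.14) FOR THE PIECES OF `G_k(0)` ON `ηℤ^{d+1}` — kernel and leg hypotheses DISCHARGED -/

section Final

/-- kernel: the common rate `δ′ = min(δa, δm)/(d+1)` is below both conversion thresholds. [folklore] -/
private theorem rate_aux {δa δm : ℝ} (hδa : 0 < δa) (hδm : 0 < δm) (d : ℕ) :
    0 < min δa δm / ((d + 1 : ℕ) : ℝ) ∧ min δa δm / ((d + 1 : ℕ) : ℝ) ≤ δa / ((d + 1 : ℕ) : ℝ) ∧
      min δa δm / ((d + 1 : ℕ) : ℝ) ≤ δm / ((d + 1 : ℕ) : ℝ) := by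
  have hd1 : (0 : ℝ) < ((d + 1 : ℕ) : ℝ) := by positivity
  exact ⟨div_pos (lt_min hδa hδm) hd1, div_le_div_of_nonneg_right (min_le_left _ _) hd1.le,
    div_le_div_of_nonneg_right (min_le_right _ _) hd1.le⟩

/-- **(3.13) p. 436 on the printed carrier with the KERNEL HYPOTHESES DISCHARGED** (external leg `φ′` kept under its printed Hölder
hypothesis): there are `δ′, C′ > 0` (functions of `d, L, window`) such that for every `k ≥ 1`, window point, all line indices `j, j′`,
every `0 ≤ α ≤ 1`, `H ≥ 0`, `‖q·‖ ≤ Q‖·‖`, `|g|,|g′| ≤ 1`, fields `φ, φ′` with `‖(∂^η_μφ′)(z) − (∂^η_μφ′)(z′)‖ ≤ H(η|z−z′|₁)^α` and finite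
localization sets: `|(3.12)[G^η_{(j)}(0), G^η_{(j′)}(0); φ, φ′]| ≤ C′Q²H(m·m^α)Σ_{x∈Λ,x′∈Λ′}η^{2(d+1)}‖φ(x)‖(L^jη)^{−(d+1)}e^{−½δ′η|x−x′|₁/L^jη}
(L^{j′}η)^{2−(d+1)}e^{−½δ′η|x−x′|₁/L^{j′}η}`, `m = min(L^jη, L^{j′}η)` (`B3Ineq313Lattice.abs_term312Z_le` + §3).
[cite: Balaban1983Higgs3, (3.13) p.436] -/
theorem abs_term312Z_le_zeroLattice (d ℓ : ℕ) (hℓ : 1 ≤ ℓ) (amin aplus m2plus : ℝ) (ha : 0 < amin) :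
    ∃ δ' C' : ℝ, 0 < δ' ∧ 0 < C' ∧ ∀ (k : ℕ), 1 ≤ k → ∀ (a m2 : ℝ), amin ≤ a → a ≤ aplus → 0 ≤ m2 → m2 ≤ m2plus →
      ∀ (j j' : ℕ) {W : Type u} [NormedAddCommGroup W] [InnerProductSpace ℝ W] {α H Q : ℝ}, 0 ≤ α → α ≤ 1 → 0 ≤ H →
        0 ≤ Q → ∀ (q : W →ₗ[ℝ] W), (∀ w : W, ‖q w‖ ≤ Q * ‖w‖) →
        ∀ (g g' : (Fin (d + 1) → ℤ) → ℝ), (∀ x, |g x| ≤ 1) → (∀ x, |g' x| ≤ 1) →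
        ∀ (φ φ' : (Fin (d + 1) → ℤ) → W),
          (∀ (μ : Fin (d + 1)) (z z' : Fin (d + 1) → ℤ),
            ‖pd (etaZ ℓ k)⁻¹ μ φ' z - pd (etaZ ℓ k)⁻¹ μ φ' z'‖ ≤ H * (etaZ ℓ k * dist₁ z z') ^ α) →
        ∀ (Λ Λ' : Finset (Fin (d + 1) → ℤ)),
          |term312Z (etaZ ℓ k) q (gpieceZ ℓ k j a m2) (gpieceZ ℓ k j' a m2) g g' φ φ' Λ Λ'| ≤
            C' * Q ^ 2 * H * (min (scaleZ ℓ k j) (scaleZ ℓ k j') * (min (scaleZ ℓ k j) (scaleZ ℓ k j')) ^ α) *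
              ∑ x ∈ Λ, ∑ x' ∈ Λ', etaZ ℓ k ^ (2 * (d + 1)) *
                (‖φ x‖ * (scaleZ ℓ k j ^ (-((d + 1 : ℕ) : ℝ)) *
                    Real.exp (-(δ' / 2 * (scaleZ ℓ k j)⁻¹ * (etaZ ℓ k * dist₁ x x'))))
                  * (scaleZ ℓ k j' ^ (2 - ((d + 1 : ℕ) : ℝ)) *
                    Real.exp (-(δ' / 2 * (scaleZ ℓ k j')⁻¹ * (etaZ ℓ k * dist₁ x x'))))) := by
  obtain ⟨δa, Ca, hδa, hCa, hA⟩ := ineq210_zeroLatticeH d ℓ hℓ amin aplus m2plus ha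
  obtain ⟨δm, Cm, hδm, hCm, hM⟩ := abs_pieceLatMixed_le d ℓ hℓ amin aplus m2plus ha
  obtain ⟨hδ'0, hδ'a, hδ'm⟩ := rate_aux hδa hδm d
  set δ' : ℝ := min δa δm / ((d + 1 : ℕ) : ℝ) with hδ'def
  refine ⟨δ', (d + 1 : ℕ) * Cm * Ca * (2 / δ' + 8 / δ' ^ 2), hδ'0, by positivity, ?_⟩
  intro k hk a m2 h1 h2 h3 h4 j j' W _ _ α H Q hα0 hα1 hH hQ q hq g g' hg hg' φ φ' hφ' Λ Λ'
  have h210 := hA k hk a m2 h1 h2 h3 h4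
  have hMk := hM k hk
  have hGj : ∀ (μ : Fin (d + 1)) (x x' : Fin (d + 1) → ℤ),
      |dKernelZ (etaZ ℓ k)⁻¹ μ (gpieceZ ℓ k j a m2) x x'| ≤ Cm * scaleZ ℓ k j ^ (-((d + 1 : ℕ) : ℝ)) *
        Real.exp (-(δ' * (scaleZ ℓ k j)⁻¹ * (etaZ ℓ k * dist₁ x x'))) := fun μ x x' =>
    abs_dKernelZ_gpieceZ_le hℓ hk hCm.le (fun j hj μ ν x x' => hMk j hj a m2 h1 h2 h3 h4 μ ν x x') hδ'0.le hδ'm j μ x x'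
  have hGj' : ∀ x x' : Fin (d + 1) → ℤ, |gpieceZ ℓ k j' a m2 x x'| ≤ Ca * scaleZ ℓ k j' ^ (2 - ((d + 1 : ℕ) : ℝ)) *
      Real.exp (-(δ' * (scaleZ ℓ k j')⁻¹ * (etaZ ℓ k * dist₁ x x'))) := fun x x' =>
    abs_gpieceZ_le hℓ h210 hδ'0.le hδ'a j' x x'
  have h := abs_term312Z_le (etaZ ℓ k) (etaZ_pos ℓ k) hα0 hα1 hH hQ hδ'0 (scaleZ_pos ℓ k j) (scaleZ_pos ℓ k j')
    q hq (gpieceZ ℓ k j a m2) (gpieceZ ℓ k j' a m2) g g' hg hg' hGj hGj' φ φ' hφ' Λ Λ'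
  refine h.trans (le_of_eq ?_)
  ring

/-- **(3.14) p. 436 FOR THE PIECES OF `G_k(0)` ON `ηℤ^{d+1}`, KERNEL AND LEG HYPOTHESES DISCHARGED** (the `ℤ^{d+1}` twin of p20 g6's
`B3Ineq314LegZeroTorus.abs_term312_le_leg_zeroTorus`): for `L = ℓ + 1 ≥ 2`, a window `[a₋,a₊] × [0,m²₊]` (`a₋ > 0`) and a Hölder
exponent `0 ≤ α < 1` there are `δ′, C′ > 0` such that for EVERY scale `k ≥ 1` (`η = L^{−k}`), every window point, all line indices
`j, j′ ≤ j″` (*"they are earlier than the external lines"*), every charge matrix with `‖qw‖ ≤ Q‖w‖`, localizations `|g|, |g′| ≤ 1`,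
every field `φ`, vector `w`, site `x″` and finite localization sets `Λ, Λ′`, the expression (3.12) with the lines `G^η_{(j)}(0)`,
`G^η_{(j′)}(0)` (pieces of `G_k(0)`, `gpieceZ`) and the leg `φ′ = G^η_{(j″)}(0)(·,x″)w` satisfies
`|(3.12)| ≤ C′Q²‖w‖(L^{j″}η)^{1−(d+1)−α}(m·m^α)Σ_{x∈Λ,x′∈Λ′}η^{2(d+1)}‖φ(x)‖(L^jη)^{−(d+1)}e^{−½δ′η|x−x′|₁/L^jη}(L^{j′}η)^{2−(d+1)}
e^{−½δ′η|x−x′|₁/L^{j′}η}e^{−½δ′η|x−x″|₁/L^{j″}η}`, `m = min(L^jη, L^{j′}η) = L^{j₁}η` — the printed factors `(L^jη)^{−d}e^{…}(L^{j′}η)^{−d+2}e^{…}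
(L^{j₁}η)^{1+α}(L^{j″}η)^{−d+1−α}exp[−½δ₀(L^{j″}η)^{−1}dist(·,Δ(v″))]` of (3.14) with `d ↦ d + 1`, NO kernel and NO leg hypothesis
(`B3Ineq313Lattice.abs_term312Z_le_local` + §3 + `leg_holder_of_ineq211Z` + `B3Ineq211ZeroLattice.ineq210_and_211At_zeroLatticeH`).
[cite: Balaban1983Higgs3, (3.14) p.436] -/
theorem abs_term312Z_le_leg_zeroLattice (d ℓ : ℕ) (hℓ : 1 ≤ ℓ) (amin aplus m2plus : ℝ) (ha : 0 < amin) {α : ℝ}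
    (hα0 : 0 ≤ α) (hα1 : α < 1) :
    ∃ δ' C' : ℝ, 0 < δ' ∧ 0 < C' ∧ ∀ (k : ℕ), 1 ≤ k → ∀ (a m2 : ℝ), amin ≤ a → a ≤ aplus → 0 ≤ m2 → m2 ≤ m2plus →
      ∀ (j j' j'' : ℕ), j ≤ j'' → j' ≤ j'' →
        ∀ {W : Type u} [NormedAddCommGroup W] [InnerProductSpace ℝ W] {Q : ℝ}, 0 ≤ Q →
        ∀ (q : W →ₗ[ℝ] W), (∀ w : W, ‖q w‖ ≤ Q * ‖w‖) →
        ∀ (g g' : (Fin (d + 1) → ℤ) → ℝ), (∀ x, |g x| ≤ 1) → (∀ x, |g' x| ≤ 1) →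
        ∀ (φ : (Fin (d + 1) → ℤ) → W) (w : W) (x'' : Fin (d + 1) → ℤ) (Λ Λ' : Finset (Fin (d + 1) → ℤ)),
          |term312Z (etaZ ℓ k) q (gpieceZ ℓ k j a m2) (gpieceZ ℓ k j' a m2) g g' φ (legZ ℓ k j'' a m2 x'' w) Λ Λ'| ≤
            C' * Q ^ 2 * ‖w‖ * scaleZ ℓ k j'' ^ (1 - ((d + 1 : ℕ) : ℝ) - α) *
              (min (scaleZ ℓ k j) (scaleZ ℓ k j') * (min (scaleZ ℓ k j) (scaleZ ℓ k j')) ^ α) *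
              ∑ x ∈ Λ, ∑ x' ∈ Λ', etaZ ℓ k ^ (2 * (d + 1)) *
                (‖φ x‖ * (scaleZ ℓ k j ^ (-((d + 1 : ℕ) : ℝ)) *
                    Real.exp (-(δ' / 2 * (scaleZ ℓ k j)⁻¹ * (etaZ ℓ k * dist₁ x x'))))
                  * (scaleZ ℓ k j' ^ (2 - ((d + 1 : ℕ) : ℝ)) *
                    Real.exp (-(δ' / 2 * (scaleZ ℓ k j')⁻¹ * (etaZ ℓ k * dist₁ x x'))))
                  * Real.exp (-(δ' / 2 * (scaleZ ℓ k j'')⁻¹ * (etaZ ℓ k * dist₁ x x'')))) := by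
  obtain ⟨δa, Ca, hδa, hCa, hA⟩ := ineq210_and_211At_zeroLatticeH d ℓ hℓ amin aplus m2plus ha hα0 hα1
  obtain ⟨δm, Cm, hδm, hCm, hM⟩ := abs_pieceLatMixed_le d ℓ hℓ amin aplus m2plus ha
  obtain ⟨hδ'0, hδ'a, hδ'm⟩ := rate_aux hδa hδm d
  set δ' : ℝ := min δa δm / ((d + 1 : ℕ) : ℝ) with hδ'def
  refine ⟨δ', (d + 1 : ℕ) * Cm * Ca * Ca * (2 / δ' + 8 / δ' ^ 2), hδ'0, by positivity, ?_⟩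
  intro k hk a m2 h1 h2 h3 h4 j j' j'' hj hj' W _ _ Q hQ q hq g g' hg hg' φ w x'' Λ Λ'
  obtain ⟨h210, h211⟩ := hA k hk a m2 h1 h2 h3 h4
  have hMk := hM k hk
  have hs'' := scaleZ_pos ℓ k j''
  have hC₃ : 0 ≤ Ca * scaleZ ℓ k j'' ^ (1 - ((d + 1 : ℕ) : ℝ) - α) * ‖w‖ := by
    have := Real.rpow_pos_of_pos hs'' (1 - ((d + 1 : ℕ) : ℝ) - α); positivity
  have hss : max (scaleZ ℓ k j) (scaleZ ℓ k j') ≤ scaleZ ℓ k j'' := max_le (scaleZ_mono hj) (scaleZ_mono hj')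
  have hGj : ∀ (μ : Fin (d + 1)) (x x' : Fin (d + 1) → ℤ),
      |dKernelZ (etaZ ℓ k)⁻¹ μ (gpieceZ ℓ k j a m2) x x'| ≤ Cm * scaleZ ℓ k j ^ (-((d + 1 : ℕ) : ℝ)) *
        Real.exp (-(δ' * (scaleZ ℓ k j)⁻¹ * (etaZ ℓ k * dist₁ x x'))) := fun μ x x' =>
    abs_dKernelZ_gpieceZ_le hℓ hk hCm.le (fun j hj μ ν x x' => hMk j hj a m2 h1 h2 h3 h4 μ ν x x') hδ'0.le hδ'm j μ x x'
  have hGj' : ∀ x x' : Fin (d + 1) → ℤ, |gpieceZ ℓ k j' a m2 x x'| ≤ Ca * scaleZ ℓ k j' ^ (2 - ((d + 1 : ℕ) : ℝ)) *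
      Real.exp (-(δ' * (scaleZ ℓ k j')⁻¹ * (etaZ ℓ k * dist₁ x x'))) := fun x x' =>
    abs_gpieceZ_le hℓ h210 hδ'0.le hδ'a j' x x'
  have hleg := leg_holder_of_ineq211Z (W := W) hℓ hα0 hCa.le h211 hδ'0.le hδ'a j'' x'' w
  have h := abs_term312Z_le_local (etaZ ℓ k) (etaZ_pos ℓ k) hα0 hα1.le hQ hC₃ hδ'0 (scaleZ_pos ℓ k j)
    (scaleZ_pos ℓ k j') hss q hq (gpieceZ ℓ k j a m2) (gpieceZ ℓ k j' a m2) g g' hg hg' hGj hGj' φ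
    (legZ ℓ k j'' a m2 x'' w) x'' hleg Λ Λ'
  refine h.trans (le_of_eq ?_)
  ring

/-- **(3.14) in its DISPLAYED cube-localized form FOR THE PIECES OF `G_k(0)` ON `ηℤ^{d+1}`, kernel and leg hypotheses discharged**
(p. 436 *"We localize additionally the vertices in cubes Δ(v), Δ(v′)"*, the third cube `Δ(v″) ∋ x″`; `B3Ineq313Lattice.abs_term312Z_le_local_cubes`,
cubes of sides `M ≥ 1` and `M″`): with the constants of `abs_term312Z_le_leg_zeroLattice`,
`|(3.12)| ≤ C′Q²‖w‖(L^{j″}η)^{1−(d+1)−α}(m·m^α)Σ_{Δ,Δ′}(Mη)^{2(d+1)}sup_{x∈Λ∩Δ}‖φ(x)‖(L^jη)^{−(d+1)}e^{−½δ′η·dist(Δ,Δ′)/L^jη}(L^{j′}η)^{2−(d+1)}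
e^{−½δ′η·dist(Δ,Δ′)/L^{j′}η}e^{−½δ′η·dist(Δ,Δ″)/L^{j″}η}` — every printed factor of (3.14) on the printed carrier.
[cite: Balaban1983Higgs3, (3.14) p.436] -/
theorem abs_term312Z_le_leg_cubes_zeroLattice (d ℓ : ℕ) (hℓ : 1 ≤ ℓ) (amin aplus m2plus : ℝ) (ha : 0 < amin) {α : ℝ}
    (hα0 : 0 ≤ α) (hα1 : α < 1) :
    ∃ δ' C' : ℝ, 0 < δ' ∧ 0 < C' ∧ ∀ (k : ℕ), 1 ≤ k → ∀ (a m2 : ℝ), amin ≤ a → a ≤ aplus → 0 ≤ m2 → m2 ≤ m2plus →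
      ∀ (j j' j'' : ℕ), j ≤ j'' → j' ≤ j'' →
        ∀ {W : Type u} [NormedAddCommGroup W] [InnerProductSpace ℝ W] {Q : ℝ}, 0 ≤ Q →
        ∀ (q : W →ₗ[ℝ] W), (∀ w : W, ‖q w‖ ≤ Q * ‖w‖) →
        ∀ (g g' : (Fin (d + 1) → ℤ) → ℝ), (∀ x, |g x| ≤ 1) → (∀ x, |g' x| ≤ 1) →
        ∀ (φ : (Fin (d + 1) → ℤ) → W) (w : W) (x'' : Fin (d + 1) → ℤ) (Λ Λ' : Finset (Fin (d + 1) → ℤ))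
          {M : ℕ} (M'' : ℕ), 0 < M →
          |term312Z (etaZ ℓ k) q (gpieceZ ℓ k j a m2) (gpieceZ ℓ k j' a m2) g g' φ (legZ ℓ k j'' a m2 x'' w) Λ Λ'| ≤
            C' * Q ^ 2 * ‖w‖ * scaleZ ℓ k j'' ^ (1 - ((d + 1 : ℕ) : ℝ) - α) *
              (min (scaleZ ℓ k j) (scaleZ ℓ k j') * (min (scaleZ ℓ k j) (scaleZ ℓ k j')) ^ α) *
              ∑ c ∈ cubesZ M Λ, ∑ c' ∈ cubesZ M Λ', ((M : ℝ) * etaZ ℓ k) ^ (2 * (d + 1)) *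
                (supOn (fiberZ M Λ c) (fun x => ‖φ x‖) *
                  ((scaleZ ℓ k j ^ (-((d + 1 : ℕ) : ℝ)) *
                      Real.exp (-(δ' / 2 * (scaleZ ℓ k j)⁻¹ * (etaZ ℓ k * (cdistZ M M c c' : ℝ))))) *
                    (scaleZ ℓ k j' ^ (2 - ((d + 1 : ℕ) : ℝ)) *
                      Real.exp (-(δ' / 2 * (scaleZ ℓ k j')⁻¹ * (etaZ ℓ k * (cdistZ M M c c' : ℝ))))) *
                    Real.exp (-(δ' / 2 * (scaleZ ℓ k j'')⁻¹ * (etaZ ℓ k * (cdistZ M M'' c (cubeIdxZ M'' x'') : ℝ)))))) := by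
  obtain ⟨δa, Ca, hδa, hCa, hA⟩ := ineq210_and_211At_zeroLatticeH d ℓ hℓ amin aplus m2plus ha hα0 hα1
  obtain ⟨δm, Cm, hδm, hCm, hM⟩ := abs_pieceLatMixed_le d ℓ hℓ amin aplus m2plus ha
  obtain ⟨hδ'0, hδ'a, hδ'm⟩ := rate_aux hδa hδm d
  set δ' : ℝ := min δa δm / ((d + 1 : ℕ) : ℝ) with hδ'def
  refine ⟨δ', (d + 1 : ℕ) * Cm * Ca * Ca * (2 / δ' + 8 / δ' ^ 2), hδ'0, by positivity, ?_⟩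
  intro k hk a m2 h1 h2 h3 h4 j j' j'' hj hj' W _ _ Q hQ q hq g g' hg hg' φ w x'' Λ Λ' M M'' hMpos
  obtain ⟨h210, h211⟩ := hA k hk a m2 h1 h2 h3 h4
  have hMk := hM k hk
  have hs'' := scaleZ_pos ℓ k j''
  have hC₃ : 0 ≤ Ca * scaleZ ℓ k j'' ^ (1 - ((d + 1 : ℕ) : ℝ) - α) * ‖w‖ := by
    have := Real.rpow_pos_of_pos hs'' (1 - ((d + 1 : ℕ) : ℝ) - α); positivity
  have hss : max (scaleZ ℓ k j) (scaleZ ℓ k j') ≤ scaleZ ℓ k j'' := max_le (scaleZ_mono hj) (scaleZ_mono hj')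
  have hGj : ∀ (μ : Fin (d + 1)) (x x' : Fin (d + 1) → ℤ),
      |dKernelZ (etaZ ℓ k)⁻¹ μ (gpieceZ ℓ k j a m2) x x'| ≤ Cm * scaleZ ℓ k j ^ (-((d + 1 : ℕ) : ℝ)) *
        Real.exp (-(δ' * (scaleZ ℓ k j)⁻¹ * (etaZ ℓ k * dist₁ x x'))) := fun μ x x' =>
    abs_dKernelZ_gpieceZ_le hℓ hk hCm.le (fun j hj μ ν x x' => hMk j hj a m2 h1 h2 h3 h4 μ ν x x') hδ'0.le hδ'm j μ x x'
  have hGj' : ∀ x x' : Fin (d + 1) → ℤ, |gpieceZ ℓ k j' a m2 x x'| ≤ Ca * scaleZ ℓ k j' ^ (2 - ((d + 1 : ℕ) : ℝ)) *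
      Real.exp (-(δ' * (scaleZ ℓ k j')⁻¹ * (etaZ ℓ k * dist₁ x x'))) := fun x x' =>
    abs_gpieceZ_le hℓ h210 hδ'0.le hδ'a j' x x'
  have hleg := leg_holder_of_ineq211Z (W := W) hℓ hα0 hCa.le h211 hδ'0.le hδ'a j'' x'' w
  have h := abs_term312Z_le_local_cubes (etaZ ℓ k) (etaZ_pos ℓ k) hα0 hα1.le hQ hC₃ hδ'0 (scaleZ_pos ℓ k j)
    (scaleZ_pos ℓ k j') hss q hq (gpieceZ ℓ k j a m2) (gpieceZ ℓ k j' a m2) g g' hg hg' hGj hGj' φ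
    (legZ ℓ k j'' a m2 x'' w) x'' hleg Λ Λ' M'' hMpos
  refine h.trans (le_of_eq ?_)
  ring

end Final

/-! ## §6 (3.15) p. 437 on `ηℤ^{d+1}`: the resummed propagator `G_n(0)` and the summed first term -/

section Resum

variable {ℓ k : ℕ} {a m2 : ℝ}

/-- **The resummed propagator** `Σ_{j<n} G^η_{(j)}(0) = 𝒢_n` read on the `η`-lattice in the print's normalisation — the scale-`n`
propagator of `B3Ineq210ZeroLattice` (`GscaleLat n`; `n = k` is `G_k(0)` itself): the print's `G_{j″}(0)` of (3.15) (index
convention of (2.6) as in `B3Ineq210ZeroLattice`: `G_k(0) = Σ_{j=0}^{k−1} G^η_{(j)}(0)`). [cite: Balaban1983Higgs3, (3.15) p.437] -/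
def GresumZ (ℓ k n : ℕ) (a m2 : ℝ) : KernelZ d :=
  fun x x' => ((((ℓ + 1) ^ k : ℕ) : ℝ)) ^ (d + 1) * GscaleLat ℓ k n a m2 x x'

/-- the top resummed propagator is `η^{−(d+1)}G_k(0)`. [cite: Balaban1983Higgs3, (3.15) p.437] -/
theorem GresumZ_top (x x' : Fin (d + 1) → ℤ) :
    GresumZ ℓ k k a m2 x x' = ((((ℓ + 1) ^ k : ℕ) : ℝ)) ^ (d + 1) * GkLat ℓ k a m2 x x' := rfl

/-- the partial sums of (2.6): `Σ_{j<n} G^η_{(j)}(0) = 𝒢_n` (`1 ≤ n ≤ k`; `B3Ineq210ZeroLattice.sum_pieceLat` is `n = k`).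
[cite: Balaban1983Higgs3, (2.6) p.424] -/
theorem sum_pieceLat_range {n : ℕ} (hn : 1 ≤ n) (hnk : n ≤ k) (x x' : Fin (d + 1) → ℤ) :
    ∑ j ∈ Finset.range n, pieceLat ℓ k j a m2 x x' = GscaleLat ℓ k n a m2 x x' := by
  induction n with
  | zero => omega
  | succ n ih =>
    rcases Nat.eq_zero_or_pos n with h0 | hpos
    · subst h0
      simp [pieceLat_zero]
    · rw [Finset.sum_range_succ, ih hpos (by omega), pieceLat_of_pos hpos (by omega)]
      ring

/-- the §3 kernels resum to `GresumZ`: `Σ_{j<n} gpieceZ j = GresumZ n` (`1 ≤ n ≤ k`). [cite: Balaban1983Higgs3, (3.15) p.437] -/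
theorem sum_gpieceZ_range {n : ℕ} (hn : 1 ≤ n) (hnk : n ≤ k) :
    ∑ j ∈ Finset.range n, gpieceZ (d := d) ℓ k j a m2 = GresumZ ℓ k n a m2 := by
  funext x x'
  rw [Finset.sum_apply, Finset.sum_apply]
  simp only [gpieceZ, GresumZ, ← Finset.mul_sum, sum_pieceLat_range hn hnk]

variable {W : Type u} [NormedAddCommGroup W] [InnerProductSpace ℝ W]

/-- **(3.15)** p. 437 [PDF 27] FOR THE PIECES OF `G_k(0)` ON `ηℤ^{d+1}`: *"Making summations over these orderings and indices means that
we sum with respect to j, j′ from 0 to j″ … After the summations we get − Σ_μ Σ_x η^dφ(x)·[Σ_{x′}η^d Σ_ν q(∂^η_νG_{j″}(0)∂^{η*}_ν)(x,x′)q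
g(x)G_{j″}(x,x′)g′(x′)(x′_μ − x_μ)](∂^η_μφ′)(x), (3.15)"* — PROVED: the double sum of the first term of (3.11) over the indices `j, j′ < n`
of the two internal lines equals the first term with both propagators replaced by the resummed `𝒢_n = Σ_{j<n} G^η_{(j)}(0)` (`1 ≤ n ≤ k`;
the print's `n = j″ + 1` in its index convention). [cite: Balaban1983Higgs3, (3.15) p.437] -/
theorem eq315Z_zeroLattice {n : ℕ} (hn : 1 ≤ n) (hnk : n ≤ k) (q : W →ₗ[ℝ] W) (g g' : (Fin (d + 1) → ℤ) → ℝ)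
    (φ φ' : (Fin (d + 1) → ℤ) → W) (Λ Λ' : Finset (Fin (d + 1) → ℤ)) :
    ∑ j ∈ Finset.range n, ∑ j' ∈ Finset.range n,
        term311Z (etaZ ℓ k) q (gpieceZ ℓ k j a m2) (gpieceZ ℓ k j' a m2) g g' φ φ' Λ Λ' =
      term311Z (etaZ ℓ k) q (GresumZ ℓ k n a m2) (GresumZ ℓ k n a m2) g g' φ φ' Λ Λ' := by
  rw [eq315Z_resum, sum_gpieceZ_range hn hnk]

end Resum

end

end Literature.MathematicalPhysics.QuantumFieldTheory.Balaban1983to89.B3Ineq314ZeroLattice
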